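import Summits.ValiantsHypothesis.ValiantsHypothesis.Theorems.GrenetZeonZeonPoint
import Summits.ValiantsHypothesis.ValiantsHypothesis.Theorems.GrenetZeonPolySizeQPAlgebraDegreeFloor
import Literature.Computability.AlgebraicComplexity.AlgDetRepr
import HarnessLib

/-!
# Cruxes `GrenetZeon.AbelianizationQP` (stmt-ValiantsHypothesis-8063) and `GrenetZeon.PolySizeQPAlgebra`
# (stmt-8064) — THE TWO OPEN BINDERS OF THE SPLIT `AlgDcQP ⇐ 8063 ∧ 8064` CANNOT BOTH FAIL

The route derives its target `AlgDcQP` from `AbelianizationQP` (8063: every affine determinantal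
representation of `per_n` of size `m` yields an `(n^c + c, 2^((log₂ m + c)^c))`-representation) and
`PolySizeQPAlgebra` (8064: for every `c`, for all large `n`, `per_n` has NO `(m, s)`-representation
with `m ≤ n^c + c`, `s ≤ 2^((log₂ n + c)^c)`).  This file records that the two pieces are
COMPLEMENTARY up to the almost-everywhere / infinitely-often gap:

* `abelianizationQP_of_uniformAlgRepr` — if for some `c` and all large `n` the permanent `per_n`
  DOES have an `(n^c + c, 2^((log₂ n + c)^c))`-representation (a uniform failure of the `c`-instance
  of `PolySizeQPAlgebra`, at the corner of its box), then `AbelianizationQP` holds outright: for large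
  `n` that representation serves every given size-`m` determinant (`m ≥ n` by the degree of `per_n`,
  so `log₂ n ≤ log₂ m`), and the finitely many small `n` are covered by the zeon point `(n, 2^n)`
  padded by monotonicity (nothing about the given representation is used).
* `abelianizationQP_or_polySizeBox_io` — hence the DICHOTOMY: `AbelianizationQP` holds, OR for every
  `c` the box `(n^c + c, 2^((log₂ n + c)^c))` of `PolySizeQPAlgebra` is empty for INFINITELY MANY `n`
  (the i.o. form of 8064 — by monotonicity the corner decides the whole box, `polySizeBox_io_iff`).
* `polySizeBox_io_of_not_abelianizationQP` — contrapositive reading: if the abelianization crux is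
  FALSE then the `s`-axis exclusion of 8064 holds infinitely often at every `c`.
* `polySizeBox_io_of_polySizeQPAlgebra` — orientation: the a.e. piece implies its i.o. form.

Planning signal (honest): the conjunction `8063 ∧ 8064` is not a product of two independent risks —
refuting 8063 PROVES the i.o. form of 8064, and a uniform refutation of 8064 PROVES 8063; only the
a.e./i.o. gap separates "one of them is a theorem" from the present statement.  Nothing here is
progress on either crux or on VP ≠ VNP.  Axioms `propext`, `Classical.choice`, `Quot.sound`.
-/

set_option linter.dupNamespace false

noncomputable section

namespace Summit.ValiantsHypothesis.ValiantsHypothesis.Theorems.GrenetZeonAbelianizationQP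

open MvPolynomial Matrix
open Literature.Computability.AlgebraicComplexity
open Summit.ValiantsHypothesis.ValiantsHypothesis.Theses.GrenetZeon
open Summit.ValiantsHypothesis.ValiantsHypothesis.Theorems.GrenetZeonGlynn
open Summit.ValiantsHypothesis.ValiantsHypothesis.Theorems.GrenetZeonPolySizeQPAlgebra

/-- Monotonicity of the quasi-polynomial budget in both the argument and the constant:
`(L + c)^c ≤ (L' + C)^C` for `L ≤ L'`, `c ≤ C`, `1 ≤ C`. [folklore] -/
theorem qbudget_mono {L L' c C : ℕ} (hL : L ≤ L') (hc : c ≤ C) (hC : 1 ≤ C) :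
    (L + c) ^ c ≤ (L' + C) ^ C :=
  calc (L + c) ^ c ≤ (L' + C) ^ c := Nat.pow_le_pow_left (Nat.add_le_add hL hc) c
    _ ≤ (L' + C) ^ C := Nat.pow_le_pow_right (by omega) hc

/-- **A uniform failure of `PolySizeQPAlgebra` proves `AbelianizationQP`.** If for some `c` and all
`n ≥ n₀` the permanent `per_n` has an `(n^c + c, 2^((log₂ n + c)^c))`-representation, then
`AbelianizationQP` holds (with constant `max c n₀ + 1`): for `n ≥ n₀` a given affine representation
of size `m` has `m ≥ n` (degree floor, `not_hasDetRepr_perPoly_of_lt`), so `2^((log₂ n + c)^c) ≤ 2^((log₂ m + C)^C)`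
and the uniform representation serves after padding (`HasAlgDetRepr.mono`); for `1 ≤ n < n₀` the
zeon point `(n, 2^n)` (`zeonPoint_proof`, Glynn 2010 / Brand–Dell–Husfeldt 2018 §3) pads to
`(n^C + C, 2^((log₂ m + C)^C))` because `n < n₀ ≤ C ≤ (log₂ m + C)^C`. [cite: Glynn2010, Thm. 2.1] -/
theorem abelianizationQP_of_uniformAlgRepr {c n₀ : ℕ}
    (hU : ∀ n ≥ n₀, HasAlgDetRepr (perPoly (Fin n) ℂ) (n ^ c + c) (2 ^ ((Nat.log 2 n + c) ^ c))) :
    AbelianizationQP := by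
  refine ⟨max c n₀ + 1, fun n m hn hdet => ?_⟩
  set C := max c n₀ + 1 with hCdef
  have hC1 : 1 ≤ C := Nat.le_add_left 1 _
  have hcC : c ≤ C := (le_max_left c n₀).trans (Nat.le_succ _)
  have hn₀C : n₀ ≤ C := (le_max_right c n₀).trans (Nat.le_succ _)
  have hnm : n ≤ m := Nat.le_of_not_lt fun hlt => not_hasDetRepr_perPoly_of_lt hlt hdet
  -- the size budget `n^c + c ≤ n^C + C` and `n ≤ n^C + C`
  have hsize : n ^ c + c ≤ n ^ C + C := Nat.add_le_add (Nat.pow_le_pow_right hn hcC) hcC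
  have hsize' : n ≤ n ^ C + C := (Nat.le_self_pow (by omega) n).trans (Nat.le_add_right _ _)
  by_cases hlarge : n₀ ≤ n
  · -- large `n`: the uniform representation, padded
    show HasAlgDetRepr (perPoly (Fin n) ℂ) (n ^ C + C) (2 ^ ((Nat.log 2 m + C) ^ C))
    exact (hU n hlarge).mono hsize (Nat.pow_le_pow_right Nat.two_pos
      (qbudget_mono (Nat.log_mono_right hnm) hcC hC1))
  · -- small `n`: the zeon point, padded (`n < n₀ ≤ C ≤ (log₂ m + C)^C`)
    push Not at hlarge
    have hexp : n ≤ (Nat.log 2 m + C) ^ C :=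
      calc n ≤ C := hlarge.le.trans hn₀C
        _ ≤ Nat.log 2 m + C := Nat.le_add_left _ _
        _ ≤ (Nat.log 2 m + C) ^ C := Nat.le_self_pow (by omega) _
    show HasAlgDetRepr (perPoly (Fin n) ℂ) (n ^ C + C) (2 ^ ((Nat.log 2 m + C) ^ C))
    exact (show HasAlgDetRepr (perPoly (Fin n) ℂ) n (2 ^ n) from zeonPoint_proof n).mono hsize'
      (Nat.pow_le_pow_right Nat.two_pos hexp)

/-- **Dichotomy.** Either `AbelianizationQP` (crux 8063) holds, or for EVERY `c` the permanent
`per_n` has no `(n^c + c, 2^((log₂ n + c)^c))`-representation for infinitely many `n` — the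
infinitely-often form of `PolySizeQPAlgebra` (crux 8064). [cite: Glynn2010, Thm. 2.1] -/
theorem abelianizationQP_or_polySizeBox_io :
    AbelianizationQP ∨
      ∀ c n₀ : ℕ, ∃ n ≥ n₀,
        ¬ HasAlgDetRepr (perPoly (Fin n) ℂ) (n ^ c + c) (2 ^ ((Nat.log 2 n + c) ^ c)) := by
  by_cases h : ∃ c n₀ : ℕ, ∀ n ≥ n₀,
      HasAlgDetRepr (perPoly (Fin n) ℂ) (n ^ c + c) (2 ^ ((Nat.log 2 n + c) ^ c))
  · obtain ⟨c, n₀, hU⟩ := h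
    exact Or.inl (abelianizationQP_of_uniformAlgRepr hU)
  · push Not at h
    exact Or.inr h

/-- **If the abelianization crux fails, the `s`-axis exclusion holds infinitely often**: `¬ 8063`
implies, for every `c`, infinitely many `n` at which the whole box `m ≤ n^c + c`,
`s ≤ 2^((log₂ n + c)^c)` of `PolySizeQPAlgebra` contains no representation of `per_n`.
[cite: Glynn2010, Thm. 2.1] -/
theorem polySizeBox_io_of_not_abelianizationQP (h : ¬ AbelianizationQP) (c n₀ : ℕ) :
    ∃ n ≥ n₀, ∀ m s : ℕ, m ≤ n ^ c + c → s ≤ 2 ^ ((Nat.log 2 n + c) ^ c) →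
      ¬ HasAlgDetRepr (perPoly (Fin n) ℂ) m s := by
  obtain ⟨n, hn, hno⟩ := (abelianizationQP_or_polySizeBox_io.resolve_left h) c n₀
  exact ⟨n, hn, fun m s hm hs hrep => hno (hrep.mono hm hs)⟩

/-- The corner decides the box: "no `(n^c + c, 2^((log₂ n + c)^c))`-representation" is equivalent
to "no `(m, s)`-representation anywhere in the box `m ≤ n^c + c`, `s ≤ 2^((log₂ n + c)^c)`"
(`HasAlgDetRepr.mono`, Mignon–Ressayre padding `A ⊕ 1`). [cite: MignonRessayre2004, §1] -/
theorem polySizeBox_iff_corner (n c : ℕ) :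
    (∀ m s : ℕ, m ≤ n ^ c + c → s ≤ 2 ^ ((Nat.log 2 n + c) ^ c) →
        ¬ HasAlgDetRepr (perPoly (Fin n) ℂ) m s) ↔
      ¬ HasAlgDetRepr (perPoly (Fin n) ℂ) (n ^ c + c) (2 ^ ((Nat.log 2 n + c) ^ c)) :=
  ⟨fun h => h _ _ le_rfl le_rfl, fun h _ _ hm hs hrep => h (hrep.mono hm hs)⟩

/-- Orientation: the piece `PolySizeQPAlgebra` (almost-everywhere form) implies its
infinitely-often form at the corner of every box (the route statement inlines `HasAlgDetRepr`,
`hasAlgDetRepr_iff`). [cite: MignonRessayre2004, §1] -/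
theorem polySizeBox_io_of_polySizeQPAlgebra (hP : PolySizeQPAlgebra) (c n₀ : ℕ) :
    ∃ n ≥ n₀, ¬ HasAlgDetRepr (perPoly (Fin n) ℂ) (n ^ c + c) (2 ^ ((Nat.log 2 n + c) ^ c)) := by
  obtain ⟨n₁, h⟩ := hP c
  exact ⟨max n₀ n₁, le_max_left _ _, h _ (le_max_right _ _) _ _ le_rfl le_rfl⟩

/-- **Equivalent form of the dichotomy as an implication between the cruxes' negations**:
a UNIFORM counterexample family to `PolySizeQPAlgebra` at one exponent `c` (representations in the
box for all large `n`) is incompatible with `¬ AbelianizationQP`. [cite: Glynn2010, Thm. 2.1] -/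
theorem not_uniformAlgRepr_of_not_abelianizationQP (h : ¬ AbelianizationQP) (c n₀ : ℕ) :
    ¬ ∀ n ≥ n₀, HasAlgDetRepr (perPoly (Fin n) ℂ) (n ^ c + c) (2 ^ ((Nat.log 2 n + c) ^ c)) :=
  fun hU => h (abelianizationQP_of_uniformAlgRepr hU)

end Summit.ValiantsHypothesis.ValiantsHypothesis.Theorems.GrenetZeonAbelianizationQP

end
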